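import Literature.MathematicalPhysics.QuantumFieldTheory.Balaban1983to89.B2Eq32FieldRegularity
import Literature.MathematicalPhysics.QuantumFieldTheory.Balaban1983to89.B2Ineq329RegularField
import Literature.MathematicalPhysics.QuantumFieldTheory.Balaban1983to89.B2Prop31Thresholds

/-!
# `Balaban1983to89.B2Prop31PrintedRestrictions` — [Balaban1982Higgs2] Proposition 3.1 (3.26) p. 589 for the §3 field
`Ã^ε` of (3.2)–(3.4) UNDER THE PRINTED RESTRICTIONS: the family `printedP31Fam` of `B2.P31Setting` whose `restricted` is the
list of printed thresholds in physical units — Lemma 2.3 (2.59)/(2.60) for `A^{(k),ε}` (and, on the `θ_{k+1}`-slice, for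
`A^{(k+1),ε}`), the restriction (2.17)/(2.97) on `A_{k+1}(y′) − A_k(y)`, and the scalar-field threshold (2.55)₄/(3.15)₂
`|φ_k| ≤ O(1)λ(Lᵏε)^{−1/4}p(Lᵏε)` — with NO regularity modulus `δ_k`, NO sup-modulus `Ψ_k`, NO smallness and NO exponent
bookkeeping assumed: the regularity of `Ã^ε` on `Bᵏ(Λ_k)` is DERIVED (`B2Eq32FieldRegularity.field32_regular_tower`), the
smallness *"for e(Lᵏε) sufficiently small"* is DERIVED from `Lᴷε ≤ ε₀` (`SmallEps`), and the printed error `O((Lᵏε)^{κ₀})|Λ_k|`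
is DERIVED by the arithmetic lemma `err_le_of_thresholds` for every exponent `0 < κ₀ < 2 − d/2`; conclusion
**`prop31Printed_thresholds : B2.Prop31Printed Q (printedP31Fam Q Γ m²)`** (both conjuncts)

statement-level skeleton of published theorems with citation tags; proofs where landed; nothing here is a claim about the Yang–Mills mass gap

CITATION HEADER.  T. Bałaban, *(Higgs)₂,₃ quantum fields in a finite volume. II. An upper bound*, Commun. Math. Phys. **86**
(1982) 555–594 [Balaban1982Higgs2] (PDF held `paper:balaban1982-cmp86-higgs23-ii`, journal page = PDF page + 554; pp. 557,
559–560, 567, 570–571, 576–577, 586, 589–590 READ AS IMAGES on the ×2 renders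
`run/shared/lean/pub/pub-balaban/b2b-balaban-ref1/pages/1982-cmp86-higgs23-II/1982-cmp86-higgs23-II-p003/p005/p006/p013/p016/p017/p022/p023/p032/p035/p036-x2.png`;
part I [Balaban1982Higgs1] p. 607 (1.22)–(1.23) on `…/1982-cmp85-higgs23-I/1982-cmp85-higgs23-I-p005-x2.png`; [Balaban1983RegularityDecay]
p. 574 on `…/1983-cmp89-regularity-decay/1983-cmp89-regularity-decay-p004-x2.png`).  Cell `lit-balaban` (HOME
`run/shared/lean/pub/lit-balaban/`), Phase-2 proof seat **p23** gen 10 (unit `lit-balaban-p23-g10`), companion of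
`B2Eq32FieldRegularity` (same gen).  SKELETON rows **B2.Prop3.1** (decl of record `B2.Prop31Printed`) and **B2.Eq3.29**; owner r02,
second reader r14, referee ref-4.  This file answers r02's HEAD CRITERION (HOME/lit-balaban-p23/INBOX.md 2026-08-21T21:31Z: *"`restricted`
:= {Ã δ_k-regular … with δ_k ≤ the (2.55)/(3.21) derivative threshold …} ∧ {sup |φ_k| ≤ Ψ_k := the (2.55)/(3.15)–(3.16) threshold
c₁p(Lᵏε)λ(Lᵏε)^{−1/4} in physical units} ∧ {Lᵏε ≤ ε₀}, plus a separate ARITHMETIC lemma `err_le_of_thresholds`"*) and items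
(d1)–(d3) of HOME/GAPS.md G-B2-07 (ix) (r14 g10), going one step further on (d1): even the regularity of `Ã^ε` is derived, from
the structure (3.2)–(3.4) and Lemma 2.3's printed conclusions.  PRECEDENTS BY NAME: p23 g9 `B2Prop31RegularFamily` (the family
with ASSUMED moduli `δ_k`, `Ψ_k`, `hAbs` — superseded in faithfulness, not edited), `B2Ineq329RegularField.prop31_regular_tower`
((3.26) restricted clause at a regular field), p15's `B2Prop31ZeroFieldConcrete.prop31_zeroField_concrete` (zero-field clause),
`B2Eq324NestedRegions.Tower` (the regions), r14's `B2LargeField.{lambdaEps, thrPhi}` ((2.2)/(2.5) thresholds), p15's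
`B2Sect3AGaussianStep.one_add_log_inv_rpow_mul_rpow_le` (log powers lose against powers), `B1Ineq352Proof.pFn_anti`.

WHAT IS PRINTED.  Prop. 3.1 p. 589 [PDF 35] (full quote in `B2.Prop31Printed`): *"… for arbitrary configurations Ã^ε, Φ defined by
the formulas (3.2), (3.3), (3.24), and satisfying the restrictions given by the characteristic functions in (3.21), the following
inequality holds ⟨Φ, Δ(Ã^ε)Φ⟩ ≥ γ₀Σ_{k=0}^{K}Σ_{⟨x,x′⟩⊂Λ₅⁽ᵏ⁻¹⁾′∩Λ₅⁽ᵏ⁾ᶜ}(Lᵏε)^{d−2}|U(Ã^ε(⟨x,x′⟩))φ_k(x′) − φ_k(x)|² +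
γ₀Σ_{k=0}^{K}Σ_{x}(Lᵏε)^d m²|φ_k(x)|² − Σ_{k=1}^{K}O((Lᵏε)^{κ₀})|(Λ₅⁽ᵏ⁻¹⁾′∩Λ₅⁽ᵏ⁾ᶜ)₁|,  (3.26) with κ₀ > 0. … If Ã^ε = 0, then the
inequality holds without the last sum on the right side and without any restrictions on the configuration Φ."*  The restrictions
(p. 570 [PDF 16], (2.55), the content of the characteristic functions `χ_k` of (3.21) p. 588): *"|(∂A)(b)| ≦ c₁p(L^{k−1}ε),
|A(x)| ≦ (c₁/(μ₀L^{k−1}ε))p(L^{k−1}ε), |(D_{Ā^{(k)}}φ)(b)| ≦ c₁p(L^{k−1}ε), |φ(x)| ≦ (c₁/λ(L^{k−1}ε)^{1/4})p(L^{k−1}ε) for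
x ∈ Λ₋₁^{(k−1)′}"*; p. 586 [PDF 32] (3.15): *"the fields A_l, φ_l considered on the subset Λ₋₁^{(l−1)′}∩Λ₅^{(l)c} of the
L^{l−k}-lattice satisfy the inequalities |A_l(x_l)| ≦ O(1)L^{−(l−k)d/2}(μ₀Lᵏε)⁻¹p(Lᵏε), |φ_l(x_l)| ≦ O(1)L^{−(l−k)d/4}
λ(Lᵏε)^{−1/4}p(Lᵏε)"*; p. 560 [PDF 6] (2.17): *"|B(y) − A(x)| ≦ 2Ldp(ε) for x ∈ B(y) … The same estimates as (2.16), (2.17)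
will hold for the fields in each step with ε replaced by the corresponding Lᵏε"*; Lemma 2.3 p. 571 (2.59)/(2.60) and the
mechanism (2.95)–(2.98) pp. 576–577 (quoted in the companion); p. 557: *"p(ε) = b₀(1 + log ε⁻¹)ᵖ"*, (2.5) *"λ(ε) = λε^{4−d}"*;
p. 559 (2.11): *"κ₀ = 1 for d = 3 and κ₀ = 2 − α with arbitary α > 0 for d = 2"*; p. 582: the stopping scale `Lᴷε ≤ ε₀`;
[Balaban1983RegularityDecay] p. 574 Prop. 3.1′: (3.29) holds *"for e sufficiently small"* under (1.21) `|(∂^η_μA)(x)| ≦ O(1)p(e)`.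

UNITS.  The thresholds `thr260`, `thr259`, `thr217`, `thrφ`, the derived modulus `deltaReg` (`δ_k = c_A·ε·s^{−d/2}p(s)`,
`c_A = c_θ(2c₃ + c₄) + c₅`), the smallness condition `SmallEps` and the error constant `Mconst` — with the (I.1.22)–(I.1.23)
dictionary from the print's unit-lattice statements to the physical lattices of `HiggsLattice` — live in the companion
`B2Prop31Thresholds` (same seat), whose header records the dictionary; here they are consumed by name.

WHAT THIS MODULE PROVES (kernel-checked, 0 `sorry`, standard axioms; the carrier `RMultiP` and the two families are
`def`s/`structure`s with bodies; no `Prop`-valued fact).  §2 the carrier `RMultiP` (the §3 data: tower of regions, cut-offs `θ_k`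
with their printed properties, `A₀`, the minimizers `A^{(k),ε}`, the block fields `A_k`, the configuration `Φ`; the field
`Ã^ε := field32`), `restricted` (printed thresholds only), the family `printedP31Fam`; §3 **`hreg_of_restricted`** (the regularity
of `Ã^ε` on every `Bᵏ(Λ_k)` with `δ_k = c_Aεs^{−d/2}p(s)`, from `B2Eq32FieldRegularity.field32_regular_tower`); §4
**`prop31Printed_thresholds`**: `B2.Prop31Printed Q (printedP31Fam Q Γ m²)` for every `Q` with `Q.L > 1`, `Q.a > 0`, `2 ≤ Q.d ≤ 3`,
`Q.κ₀ < 2 − Q.d/2`, every valid `Γ` with `SmallEps Q.d Q.L Γ` (*"ε₀ sufficiently small"*; inhabited by `exists_smallEps`), every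
`m² > 0`; one `γ₀ = min(a(1 − L⁻²)/(8d + 2m² + 4), 1/16)`, `C = γ₀·Mconst Γ Q.d Q.κ₀`; §5 the per-scale family `printed329Fam` and
**`ineq329Printed_thresholds`**: `B2.Ineq329Printed Q.κ₀ (printed329Fam Q Γ m²)` (`m² ≥ 0`); §6 NON-VACUITY
`exists_restricted_ne_zero`: a restricted instance with `Ã^ε ≠ 0` (one step, `θ₁ ≡ 1`, constant external field) for every
`Q.d ≥ 1`, `Q.L > 1`, valid `Γ`.
HONEST SCOPE.  (i) Lemma 2.3's conclusions (2.59)/(2.60) for `A^{(k),ε}`, `A^{(k+1),ε}` (row B2.Lem2.3, proved on `Setup`'s tori in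
`B2Lemma23Torus`, not on this carrier) and the restriction (2.17)/(2.97) enter `restricted` as printed-shape inputs (what the
characteristic functions of (3.21) deliver through Lemma 2.3) — the derivation (3.21) ⇒ (2.55) ⇒ (2.59)/(2.60) ON THIS CARRIER is
not formalized; (ii) the O(1)'s `c₃, c₄, c₅, c_θ, c_φ` and the couplings `e, λ, b₀, p` are family parameters (`Consts`), print's
values (`2Ld`, `c₁`, …) not pinned; (iii) the exponent obtained is any `κ₀ < 2 − d/2` (d = 3: `< ½`; d = 2: `< 1`), BELOW the
(2.11) `κ₀` (1, 2 − α) — Prop. 3.1 prints «with κ₀ > 0» and downstream ((2.118), (3.31)) uses only `κ₀ > 0` (GAPS G-pv07-1,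
G-B2-07 (ix)); (iv) `γ₀` depends on `d, a` and on `L, m²` as in the precedents (r14's `B2Prop31UniformConstant` makes the
printed «d and a only» literal); (v) `2 ≤ d ≤ 3` as printed (d = 2, 3); (vi) the cut-off conventions of the companion (θ at the
initial point of a bond; `θ_m = 0` for `m > K`); (vii) which `p(L^{k−1}ε)` vs `p(Lᵏε)`: thresholds are taken at `p(Lᵏε)` as in
(3.15)/(2.95) — the one-step conversion `p(L^{k−1}ε) ≤ (1 + log L)ᵖp(Lᵏε)` is absorbed in the O(1)'s (READING).
-/

noncomputable section

open MeasureTheory Finset Real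
open scoped BigOperators ENNReal InnerProductSpace

namespace Literature.MathematicalPhysics.QuantumFieldTheory.Balaban1983to89.B2Prop31PrintedRestrictions

open Literature.MathematicalPhysics.QuantumFieldTheory.Balaban1983to89.HiggsLattice
open Literature.MathematicalPhysics.QuantumFieldTheory.Balaban1983to89.HiggsAveraging
open Literature.MathematicalPhysics.QuantumFieldTheory.Balaban1983to89.HiggsCovariance
open Literature.MathematicalPhysics.QuantumFieldTheory.Balaban1983to89.HiggsCovariancePos
open Literature.MathematicalPhysics.QuantumFieldTheory.Balaban1983to89.B2Eq337ScalarIntegration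
open Literature.MathematicalPhysics.QuantumFieldTheory.Balaban1983to89.B2Eq325ConcreteSchur
open Literature.MathematicalPhysics.QuantumFieldTheory.Balaban1983to89.B2Ineq327ConcreteNeumann
open Literature.MathematicalPhysics.QuantumFieldTheory.Balaban1983to89.B2Eq328ConcretePieces
open Literature.MathematicalPhysics.QuantumFieldTheory.Balaban1983to89.B2Eq328DeltaK
open Literature.MathematicalPhysics.QuantumFieldTheory.Balaban1983to89.B2Ineq329ZeroAveraging
open Literature.MathematicalPhysics.QuantumFieldTheory.Balaban1983to89.B2Prop31ZeroFieldConcrete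
open Literature.MathematicalPhysics.QuantumFieldTheory.Balaban1983to89.B2Eq255Concrete (barA barA_zero)
open Literature.MathematicalPhysics.QuantumFieldTheory.Balaban1983to89.B2Ineq329RegularField
open Literature.MathematicalPhysics.QuantumFieldTheory.Balaban1983to89.B2Eq324NestedRegions
open Literature.MathematicalPhysics.QuantumFieldTheory.Balaban1983to89.B2Eq32FieldRegularity
open Literature.MathematicalPhysics.QuantumFieldTheory.Balaban1983to89.B2Prop31Thresholds
open B2Sect2BDensities (Nested)
open B2LargeField (lambdaEps thrPhi)

/-! ## §2 The carrier: the §3 data of Proposition 3.1 with the printed properties of the cut-offs, and `restricted` -/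

/-- **One concrete instance of Proposition 3.1 (3.26) with the §3 field `Ã^ε` of (3.2)–(3.4)** (model constants `L := Q.L`,
`d := Q.d`, `a := Q.a`, `κ₀ := Q.κ₀`; the constants `Γ`; mass `m²`): a member `P` of the lattice family (`P.L = Q.L`, `P.d = Q.d`),
`K ≤ P.K` steps with the stopping rule `Lᴷε ≤ ε₀` (p. 582), the tower of large-field regions `Λ₅⁽⁰⁾ ⊃ … ⊃ Λ₅⁽ᴷ⁾ = ∅` (whence
`Λ_k = Λ₅⁽ᵏ⁻¹⁾′ ∩ Λ₅⁽ᵏ⁾ᶜ`), the charge data with the model's coupling `e`, the cut-offs `θ_k` on `T_ε` WITH THEIR PRINTED PROPERTIES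
(p. 567: values in `[0,1]`, nested, `= 1` on `Bᵏ⁻¹(Λ₂⁽ᵏ⁻¹⁾) ⊇ Bᵏ⁻¹(Λ₅⁽ᵏ⁻¹⁾)`, supported near `Bᵏ⁻¹(Λ₂⁽ᵏ⁻¹⁾)` — inside
`Bᵏ⁻²(Λ₅⁽ᵏ⁻²⁾)` —, *"varies smoothly"*: `|θ_{k+1}(z+εe_ν) − θ_{k+1}(z)| ≤ c_θL^{−k}`; `θ_m = 0` for `m > K`), the field `A₀`, the
minimizers `A^{(k),ε}` of (3.3) (data), the block fields `A_k` on `T⁽ᵏ⁾` (data), and the configuration `Φ` of (3.24).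
[cite: Balaban1982Higgs2, Prop. 3.1 p.589, (3.2)–(3.4) p.583, (3.24) p.588, p.567, p.582] -/
structure RMultiP (Q : B2.Params) (Γ : B2Prop31Thresholds.Consts) (m2 : ℝ) where
  /-- the lattice family member (tori `T^{(k)}_{Lᵏε}`) -/
  P : HiggsLattice.Params
  hL : P.L = Q.L
  hd : P.d = Q.d
  /-- number of real field components -/
  N : ℕ
  /-- number of renormalization steps -/
  K : ℕ
  hK : K ≤ P.K
  /-- the stopping rule `Lᴷε ≤ ε₀` (p. 582) -/
  hε₀ : P.mesh K ≤ Γ.ε₀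
  /-- the tower of large-field regions `Λ₅⁽ᵏ⁾` -/
  T : Tower P K
  C : ChargeData N
  /-- the model's coupling constant -/
  hCe : C.e = Γ.e
  /-- the cut-offs `θ_k` on the fine torus -/
  θ : ℕ → HiggsLattice.Site P 0 → ℝ
  θ_nested : Nested θ
  θ_range : ∀ m (z : HiggsLattice.Site P 0), 0 ≤ θ m z ∧ θ m z ≤ 1
  /-- `θ_k = 1` on `Bᵏ⁻¹(Λ₅⁽ᵏ⁻¹⁾)` and one fine step around it -/
  θ_one : ∀ k, 1 ≤ k → k ≤ K → ∀ z : HiggsLattice.Site P 0, T.lamAt (k - 1) z → θ k z = 1 ∧ ∀ ν, θ k (z.shift ν) = 1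
  /-- the support of `θ_{k+2}` and one fine step around it lie inside `Bᵏ(Λ₅⁽ᵏ⁾)` -/
  θ_zero : ∀ k, k + 2 ≤ K → ∀ z : HiggsLattice.Site P 0,
    (θ (k + 2) z ≠ 0 ∨ ∃ ν, θ (k + 2) (z.shift ν) ≠ 0) → T.lamAt k z
  /-- no cut-offs beyond the last step -/
  θ_above : ∀ m, K < m → ∀ z : HiggsLattice.Site P 0, θ m z = 0
  /-- *"varies smoothly from 1 to 0 on a slice of thickness < M"*: `|θ_{k+1}(z + εe_ν) − θ_{k+1}(z)| ≤ c_θ·L^{−k}` -/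
  θ_lip : ∀ k (z : HiggsLattice.Site P 0) (ν : Fin P.d), |θ (k + 1) (z.shift ν) - θ (k + 1) z| ≤ Γ.cθ * ((P.L : ℝ) ^ k)⁻¹
  /-- `A₀` of (3.2) -/
  A₀ : HiggsLattice.VecField P 0
  /-- the minimizers `A^{(k),ε}` of (3.3), `k = 1, …, K` -/
  A : ℕ → HiggsLattice.VecField P 0
  /-- the block vector fields `A_k` on `T⁽ᵏ⁾` -/
  Ac : (k : ℕ) → HiggsLattice.VecField P k
  /-- the configuration `Φ = (φ₀↾Λ₅⁽⁰⁾ᶜ, φ_k↾Λ_k)` of (3.24) -/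
  Φ : Cfg T.regions N

namespace RMultiP

variable {Q : B2.Params} {Γ : B2Prop31Thresholds.Consts} {m2 : ℝ}

/-- **The field `Ã^ε` of the instance**: (3.2) built from its cut-offs, `A₀` and the minimizers
(`B2Eq32FieldRegularity.field32`). [cite: Balaban1982Higgs2, (3.2) p.583] -/
def field (i : RMultiP Q Γ m2) : HiggsLattice.VecField i.P 0 := field32 i.θ i.A₀ i.A i.K

/-- The `θ_{k+1}`-slice condition at a fine bond pair (`k = j + 1`): `θ_{k+1}(z) ≠ 0 ∨ θ_{k+1}(z + εe_ν) ≠ 0` — where the next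
minimizer `A^{(k+1),ε}` enters `Ã^ε` on `Bᵏ(Λ_k)` ((2.96)). [cite: Balaban1982Higgs2, (2.96) p.576] -/
def slice (i : RMultiP Q Γ m2) (j : Fin i.K) (z : HiggsLattice.Site i.P 0) (ν : Fin i.P.d) : Prop :=
  i.θ (j.val + 2) z ≠ 0 ∨ i.θ (j.val + 2) (z.shift ν) ≠ 0

/-- **THE PRINTED RESTRICTIONS** (*"satisfying the restrictions given by the characteristic functions in (3.21)"*, through
Lemma 2.3 for the minimizers), in physical units with `s_k = Lᵏε`, `k = j + 1`, on `Bᵏ(Λ_k)` (`pieceF`):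
(2.60) `|A^{(k),ε}(⟨z+εe_ν,μ⟩) − A^{(k),ε}(⟨z,μ⟩)| ≤ thr260(s_k)`; (2.59) `|A^{(k),ε}(⟨z,μ⟩) − A_k(z_k)_μ| ≤ thr259(s_k)`; on the
`θ_{k+1}`-slice the same two for `A^{(k+1),ε}` at `s_{k+1}` and the restriction (2.17) `|A_{k+1}(z_{k+1})_μ − A_k(z_k)_μ| ≤ thr217(s_k)`;
and (2.55)₄/(3.15)₂ `‖φ_k(y)‖ ≤ thrφ(s_k)` on `Λ_k`.  NO modulus `δ_k`, `Ψ_k`, smallness or exponent bookkeeping is assumed.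
[cite: Balaban1982Higgs2, Prop. 3.1 p.589, (3.21) p.588, (2.55) p.570, (2.59)–(2.60) p.571, (2.17) p.560, (3.15) p.586] -/
def restricted (i : RMultiP Q Γ m2) : Prop :=
  (∀ (j : Fin i.K), ∀ z ∈ pieceF i.T.regions j, ∀ μ ν : Fin i.P.d,
      |i.A (j.val + 1) ⟨z.shift ν, μ⟩ - i.A (j.val + 1) ⟨z, μ⟩| ≤ thr260 Γ i.P.d i.P.ε (i.P.mesh (j.val + 1)))
  ∧ (∀ (j : Fin i.K), ∀ z ∈ pieceF i.T.regions j, ∀ μ : Fin i.P.d,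
      |i.A (j.val + 1) ⟨z, μ⟩ - i.Ac (j.val + 1) ⟨blockIter (j.val + 1) z, μ⟩| ≤ thr259 Γ i.P.d (i.P.mesh (j.val + 1)))
  ∧ (∀ (j : Fin i.K), ∀ z ∈ pieceF i.T.regions j, ∀ μ ν : Fin i.P.d, i.slice j z ν →
      |i.A (j.val + 2) ⟨z.shift ν, μ⟩ - i.A (j.val + 2) ⟨z, μ⟩| ≤ thr260 Γ i.P.d i.P.ε (i.P.mesh (j.val + 2)))
  ∧ (∀ (j : Fin i.K), ∀ z ∈ pieceF i.T.regions j, ∀ μ ν : Fin i.P.d, i.slice j z ν →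
      |i.A (j.val + 2) ⟨z, μ⟩ - i.Ac (j.val + 2) ⟨blockIter (j.val + 2) z, μ⟩| ≤ thr259 Γ i.P.d (i.P.mesh (j.val + 2)))
  ∧ (∀ (j : Fin i.K), ∀ z ∈ pieceF i.T.regions j, ∀ μ ν : Fin i.P.d, i.slice j z ν →
      |i.Ac (j.val + 2) ⟨blockIter (j.val + 2) z, μ⟩ - i.Ac (j.val + 1) ⟨blockIter (j.val + 1) z, μ⟩|
        ≤ thr217 Γ i.P.d (i.P.mesh (j.val + 1)))
  ∧ (∀ (j : Fin i.K) (y : LSite i.T.regions j), ‖resL i.T.regions j i.Φ y‖ ≤ thrφ Γ i.P.d (i.P.mesh (j.val + 1)))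

/-- The k-th covariant bond sum of (3.26) for the instance's field `Ã^ε`, `k = j + 1`. [cite: Balaban1982Higgs2, Prop. 3.1 (3.26) p.589] -/
def bondKA (i : RMultiP Q Γ m2) (j : Fin i.K) : ℝ :=
  ∑ c : HiggsLattice.PBond i.P (j.val + 1), if Inside (i.T.regions.block j) c then
    i.P.mesh (j.val + 1) ^ i.P.d *
      ‖covDeriv i.C (barA (j.val + 1) i.field) (extL i.T.regions j (resL i.T.regions j i.Φ)) c‖ ^ 2 else 0

/-- `|(Λ₅⁽ᵏ⁻¹⁾′∩Λ₅⁽ᵏ⁾ᶜ)₁| = |Λ_k|` for `k = 1, …, K` (and `0` otherwise). [cite: Balaban1982Higgs2, Prop. 3.1 (3.26) p.589] -/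
def vol (i : RMultiP Q Γ m2) (k : ℕ) : ℕ :=
  if h : 0 < k ∧ k - 1 < i.K then (i.T.regions.block ⟨k - 1, h.2⟩).card else 0

/-- `vol (j+1) = |Λ_{j+1}|`. [cite: Balaban1982Higgs2, Prop. 3.1 (3.26) p.589] -/
theorem vol_succ (i : RMultiP Q Γ m2) (j : Fin i.K) : i.vol (j.val + 1) = (i.T.regions.block j).card := by
  unfold vol
  rw [dif_pos ⟨Nat.succ_pos _, by simp [j.isLt]⟩]
  congr 2

/-- `s_{j+1} = L^{j+1}·ε` (definitional for `HiggsLattice.Params.mesh`). [cite: Balaban1982Higgs1, (1.19) p.607] -/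
theorem mesh_eq_pow_mul_eps (i : RMultiP Q Γ m2) (k : ℕ) : (i.P.L : ℝ) ^ k * i.P.ε = i.P.mesh k := rfl

/-- `0 < s_k ≤ ε₀ ≤ 1` for `k ≤ K`. [cite: Balaban1982Higgs2, p.582] -/
theorem mesh_le_eps0 (i : RMultiP Q Γ m2) {k : ℕ} (hk : k ≤ i.K) : i.P.mesh k ≤ Γ.ε₀ :=
  (mesh_le_mesh hk).trans i.hε₀

end RMultiP

/-- **THE FAMILY OF `B2.P31Setting` OVER THE PRINTED RESTRICTIONS**: `ε`, `K`, `restricted` (above), `zeroField := (Ã^ε = 0)`,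
`form = ⟨Φ, Δ(Ã^ε)Φ⟩ = form325`, `formN = form325N` ((3.27)), `term k` = the k-th term of (3.28), `bond k`/`mass k` = the k-th
covariant bond / mass sums of (3.26), `vol k = |Λ_k|`. [cite: Balaban1982Higgs2, Prop. 3.1 (3.26)–(3.28) p.589] -/
def printedP31Fam (Q : B2.Params) (Γ : B2Prop31Thresholds.Consts) (m2 : ℝ) (i : RMultiP Q Γ m2) : B2.P31Setting where
  ε := i.P.mesh 0
  K := i.K
  restricted := i.restricted
  zeroField := i.field = 0
  form := form325 i.T.regions i.C Q.a i.field m2 i.Φ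
  formN := form325N i.T.regions i.C Q.a i.T.nested_regions.pieces i.field m2 i.Φ
  term := natExt (outTerm i.T.regions i.C i.field m2 i.Φ.1)
    fun j => termForm i.T.regions i.C Q.a i.field m2 j (resL i.T.regions j i.Φ)
  bond := natExt (bond0 i.T.regions i.C i.field i.Φ.1) fun j => i.bondKA j
  mass := natExt (mass0 i.T.regions m2 i.Φ.1) fun j => massK i.T.regions m2 j (resL i.T.regions j i.Φ)
  vol := i.vol

/-! ## §3 The regularity of `Ã^ε` on every `Bᵏ(Λ_k)` from the printed restrictions -/

section Derived

variable {Q : B2.Params} {Γ : B2Prop31Thresholds.Consts} {m2 : ℝ}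

/-- **THE REGULARITY OF `Ã^ε` DERIVED**: for a restricted instance with `d ≥ 2`, on every `Bᵏ(Λ_k)` (`k = j + 1 = 1, …, K`)
`|Ã^ε(⟨z+εe_ν,μ⟩) − Ã^ε(⟨z,μ⟩)| ≤ δ_k = c_A·ε·s_k^{−d/2}p(s_k)` — `B2Eq32FieldRegularity.field32_regular_tower` fed with the printed
thresholds (the level-`(k+1)` inputs on the slice bounded by the level-`k` thresholds, `thr259_anti`/`thr260_anti`: `s_k ≤ s_{k+1} ≤ 1`),
the cut-off properties of the carrier, and the identity `deltaReg_eq`. [cite: Balaban1982Higgs2, (2.98) p.577, Prop. 3.1 p.589]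
[cite: Balaban1983RegularityDecay, Prop. 3.1′ (1.21) p.574] -/
theorem hreg_of_restricted (hΓ : Γ.Valid) (i : RMultiP Q Γ m2) (hd : 2 ≤ i.P.d) (hr : i.restricted) :
    ∀ (j : Fin i.K), ∀ z ∈ pieceF i.T.regions j, ∀ μ' ν : Fin i.P.d,
      |i.field ⟨z.shift ν, μ'⟩ - i.field ⟨z, μ'⟩| ≤ deltaReg Γ i.P.d i.P.ε (i.P.mesh (j.val + 1)) := by
  obtain ⟨h260, h259, h260', h259', h217, -⟩ := hr
  have hLpos : (0 : ℝ) < i.P.L := by exact_mod_cast i.P.hL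
  have hmpos : ∀ k, 0 < i.P.mesh k := fun k => i.P.mesh_pos k
  -- comparison of consecutive scales: `s_{j+1} ≤ s_{j+2} ≤ 1` when `j + 2 ≤ K`
  have hstep : ∀ j : Fin i.K, i.P.mesh (j.val + 1) ≤ i.P.mesh (j.val + 2) := fun j => mesh_le_mesh (by omega)
  have htop1 : ∀ j : Fin i.K, j.val + 2 ≤ i.K → i.P.mesh (j.val + 2) ≤ 1 :=
    fun j hj => (i.mesh_le_eps0 hj).trans hΓ.ε₀_le_one
  have hsl_le : ∀ (j : Fin i.K) (z : HiggsLattice.Site i.P 0) (ν : Fin i.P.d), i.slice j z ν → j.val + 2 ≤ i.K := by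
    intro j z ν hsl
    by_contra hK
    have h0 := i.θ_above (j.val + 2) (by omega)
    rcases hsl with h | h
    · exact h (h0 z)
    · exact h (h0 (z.shift ν))
  refine field32_regular_tower i.T i.θ i.A₀ i.A i.θ_nested i.θ_range i.θ_one i.θ_zero i.θ_above
    (fun k z μ => i.Ac k ⟨blockIter k z, μ⟩)
    (ϑ := fun j => Γ.cθ * ((i.P.L : ℝ) ^ (j.val + 1))⁻¹)
    (α := fun j => thr259 Γ i.P.d (i.P.mesh (j.val + 1))) (α' := fun j => thr259 Γ i.P.d (i.P.mesh (j.val + 1)))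
    (β := fun j => thr217 Γ i.P.d (i.P.mesh (j.val + 1)))
    (γ := fun j => thr260 Γ i.P.d i.P.ε (i.P.mesh (j.val + 1)))
    (γ' := fun j => thr260 Γ i.P.d i.P.ε (i.P.mesh (j.val + 1)))
    (δ := fun j => deltaReg Γ i.P.d i.P.ε (i.P.mesh (j.val + 1)))
    (fun j => mul_nonneg hΓ.cθ_nonneg (inv_nonneg.2 (pow_nonneg hLpos.le _)))
    (fun j => ?_) (fun j => ?_) (fun j => ?_)
    (fun j z _ ν => i.θ_lip (j.val + 1) z ν)
    (fun j z hz μ => h259 j z hz μ) (fun j z hz μ ν => h260 j z hz μ ν)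
    (fun j z hz μ ν hsl => ?_) (fun j z hz μ ν hsl => h217 j z hz μ ν hsl) (fun j z hz μ ν hsl => ?_) (fun j => ?_)
  · -- `α ≥ 0`
    exact mul_nonneg (mul_nonneg hΓ.c₃_nonneg (Real.rpow_nonneg (hmpos _).le _))
      (pFn_nonneg' hΓ (hmpos _) ((i.mesh_le_eps0 (Nat.succ_le_of_lt j.isLt)).trans hΓ.ε₀_le_one))
  · exact mul_nonneg (mul_nonneg hΓ.c₃_nonneg (Real.rpow_nonneg (hmpos _).le _))
      (pFn_nonneg' hΓ (hmpos _) ((i.mesh_le_eps0 (Nat.succ_le_of_lt j.isLt)).trans hΓ.ε₀_le_one))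
  · -- `β ≥ 0`
    exact mul_nonneg (mul_nonneg hΓ.c₄_nonneg (Real.rpow_nonneg (hmpos _).le _))
      (pFn_nonneg' hΓ (hmpos _) ((i.mesh_le_eps0 (Nat.succ_le_of_lt j.isLt)).trans hΓ.ε₀_le_one))
  · -- (2.59) at level k+1 on the slice, bounded by the level-k threshold
    exact (h259' j z hz μ ν hsl).trans (thr259_anti hΓ hd (hmpos _) (hstep j) (htop1 j (hsl_le j z ν hsl)))
  · -- (2.60) at level k+1 on the slice, bounded by the level-k threshold
    exact (h260' j z hz μ ν hsl).trans
      (thr260_anti hΓ i.P.d i.P.hε.le (hmpos _) (hstep j) (htop1 j (hsl_le j z ν hsl)))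
  · -- `ϑ(α + α′ + β) + max(γ, γ′) = δ`
    rw [max_self]
    exact le_of_eq (deltaReg_eq i.P.d (hmpos _) (i.mesh_eq_pow_mul_eps (j.val + 1)))

end Derived

/-! ## §4 `B2.Prop31Printed` on the family over the printed restrictions -/

section Main

variable {Q : B2.Params} {Γ : B2Prop31Thresholds.Consts} {m2 : ℝ}

/-- `Σ_{k=1}^{K} g k = Σ_{j<K} g (j+1)`. [folklore] -/
private theorem sum_Icc_eq_sum_fin' (K : ℕ) (g : ℕ → ℝ) : ∑ k ∈ Finset.Icc 1 K, g k = ∑ j : Fin K, g (j.val + 1) := by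
  have h : ∑ k ∈ Finset.range (K + 1), g k = g 0 + ∑ k ∈ Finset.Icc 1 K, g k := by
    rw [Finset.sum_range_eq_add_Ico _ (by omega : 0 < K + 1), Finset.Ico_add_one_right_eq_Icc]
  have h2 : ∑ k ∈ Finset.range (K + 1), g k = g 0 + ∑ j : Fin K, g (j.val + 1) := by
    rw [Finset.sum_range_succ', add_comm, Finset.sum_range]
  linarith

/-- At `Ã^ε = 0` the covariant bond sum of (3.26) is p15's zero-field bond sum `bondK` (`Ā⁽ᵏ⁾(0) = 0`, `U(0) = 1`).
[cite: Balaban1982Higgs2, Prop. 3.1 (3.26) p.589] -/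
private theorem bondSum_zero {P : HiggsLattice.Params} {N K : ℕ} (R : Regions P K) (C : ChargeData N) (j : Fin K)
    (ψ : LSite R j → V N) :
    (∑ c : HiggsLattice.PBond P (j.val + 1), if Inside (R.block j) c then
        P.mesh (j.val + 1) ^ P.d * ‖covDeriv C (barA (j.val + 1) (0 : HiggsLattice.VecField P 0)) (extL R j ψ) c‖ ^ 2
        else 0) = bondK R j ψ := by
  rw [bondK, barA_zero]
  refine Finset.sum_congr rfl fun c _ => ?_
  split_ifs
  · rw [HiggsLattice.covDeriv_zero]
  · rfl

/-- `min(a_∞/(8d+2m²+4), 1/16) ≤ gamma0 = min(a_∞/(8d+2m²), 1/4)` (`a_∞ = a(1 − L⁻²) > 0`).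
[cite: Balaban1982Higgs2, Prop. 3.1 p.589] -/
private theorem gamma0_le {P : HiggsLattice.Params} {a msq : ℝ} (ha : 0 < a) (hL : 1 < P.L) (hmsq : 0 ≤ msq) :
    min (a * (1 - ((P.L : ℝ) ^ 2)⁻¹) / (8 * P.d + 2 * msq + 4)) (1 / 16) ≤ gamma0 P a msq := by
  have hL' : (1 : ℝ) < P.L := by exact_mod_cast hL
  have hd : (1 : ℝ) ≤ P.d := by exact_mod_cast P.hd
  have hainf0 : 0 < a * (1 - ((P.L : ℝ) ^ 2)⁻¹) := by
    have h1 : (1 : ℝ) < (P.L : ℝ) ^ 2 := by nlinarith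
    have : ((P.L : ℝ) ^ 2)⁻¹ < 1 := inv_lt_one_of_one_lt₀ h1
    exact mul_pos ha (by linarith)
  have hB : 0 < 8 * (P.d : ℝ) + 2 * msq := by linarith
  unfold gamma0
  refine le_min ?_ ((min_le_right _ _).trans (by norm_num))
  refine (min_le_left _ _).trans ?_
  exact div_le_div_of_nonneg_left hainf0.le hB (by linarith)

/-- **PROPOSITION 3.1 (3.26) — `B2.Prop31Printed Q` — HOLDS ON THE FAMILY OVER THE PRINTED RESTRICTIONS**, BOTH conjuncts:
for every parameter record `Q` with `Q.L > 1`, `Q.a > 0`, `2 ≤ Q.d ≤ 3` (print: d = 2, 3) and ANY exponent `0 < Q.κ₀ < 2 − Q.d/2`,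
every valid constants `Γ` whose stopping scale `ε₀` is small (`SmallEps`, *"e(Lᵏε) sufficiently small"*), every `m² > 0`:
there are `γ₀ = min(a(1 − L⁻²)/(8d + 2m² + 4), 1/16) > 0` and `C = γ₀·Mconst ≥ 0` such that EVERY restricted instance satisfies
(3.26) with error `Σ_{k=1}^{K} C(Lᵏε)^{κ₀}|Λ_k|` — the regularity of `Ã^ε` on `Bᵏ(Λ_k)` (`hreg_of_restricted`), the smallness
(`small_of_thresholds`) and the exponent bookkeeping (`err_le_of_thresholds`) all DERIVED, then
`B2Ineq329RegularField.prop31_regular_tower` —, and EVERY instance with `Ã^ε = 0` satisfies it *"without the last sum … and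
without any restrictions on the configuration Φ"* (p15's `prop31_zeroField_concrete`).
[cite: Balaban1982Higgs2, Prop. 3.1 (3.26) p.589, (3.29) p.590] [cite: Balaban1983RegularityDecay, Prop. 3.1′ p.574] -/
theorem prop31Printed_thresholds (Q : B2.Params) (hQL : 1 < Q.L) (hQa : 0 < Q.a) (hQd2 : 2 ≤ Q.d) (hQd3 : Q.d ≤ 3)
    (hκ : Q.κ₀ < 2 - (Q.d : ℝ) / 2) (Γ : B2Prop31Thresholds.Consts) (hΓ : Γ.Valid) (hsm : SmallEps Q.d Q.L Γ) {m2 : ℝ}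
    (hm : 0 < m2) : B2.Prop31Printed Q (printedP31Fam Q Γ m2) := by
  set γ₀ : ℝ := min (Q.a * (1 - ((Q.L : ℝ) ^ 2)⁻¹) / (8 * Q.d + 2 * m2 + 4)) (1 / 16) with hγ₀
  have hQL' : (1 : ℝ) < Q.L := by exact_mod_cast hQL
  have hQd' : (2 : ℝ) ≤ Q.d := by exact_mod_cast hQd2
  have hB0 : 0 < 8 * (Q.d : ℝ) + 2 * m2 + 4 := by linarith
  have hainf0 : 0 < Q.a * (1 - ((Q.L : ℝ) ^ 2)⁻¹) := by
    have h1 : (1 : ℝ) < (Q.L : ℝ) ^ 2 := by nlinarith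
    have : ((Q.L : ℝ) ^ 2)⁻¹ < 1 := inv_lt_one_of_one_lt₀ h1
    exact mul_pos hQa (by linarith)
  have hγpos : 0 < γ₀ := lt_min (div_pos hainf0 hB0) (by norm_num)
  have hγ16 : γ₀ ≤ 1 / 16 := min_le_right _ _
  have hγB : γ₀ * (8 * Q.d + 2 * m2 + 4) ≤ Q.a * (1 - ((Q.L : ℝ) ^ 2)⁻¹) := by
    calc γ₀ * (8 * Q.d + 2 * m2 + 4) ≤ Q.a * (1 - ((Q.L : ℝ) ^ 2)⁻¹) / (8 * Q.d + 2 * m2 + 4) * (8 * Q.d + 2 * m2 + 4) :=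
          mul_le_mul_of_nonneg_right (min_le_left _ _) hB0.le
      _ = Q.a * (1 - ((Q.L : ℝ) ^ 2)⁻¹) := div_mul_cancel₀ _ hB0.ne'
  have hM := Mconst_nonneg hΓ Q.d Q.κ₀
  refine ⟨γ₀, γ₀ * Mconst Γ Q.d Q.κ₀, hγpos, mul_nonneg hγpos.le hM, fun i hr => ?_, fun i hz => ?_⟩
  · -- the restricted clause
    have hL : 1 < i.P.L := by rw [i.hL]; exact hQL
    have hd2 : 2 ≤ i.P.d := by rw [i.hd]; exact hQd2
    have hd3 : i.P.d ≤ 3 := by rw [i.hd]; exact hQd3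
    have hε1 : i.P.mesh i.K ≤ 1 := i.hε₀.trans hΓ.ε₀_le_one
    have hγB' : γ₀ * (8 * i.P.d + 2 * m2 + 4) ≤ Q.a * (1 - ((i.P.L : ℝ) ^ 2)⁻¹) := by rw [i.hd, i.hL]; exact hγB
    have hsm' : SmallEps i.P.d i.P.L Γ := by rw [i.hd, i.hL]; exact hsm
    have hκ' : Q.κ₀ < 2 - (i.P.d : ℝ) / 2 := by rw [i.hd]; exact hκ
    -- the derived inputs of `prop31_regular_tower`
    have hreg := hreg_of_restricted hΓ i hd2 hr
    have hδ : ∀ j : Fin i.K, 0 ≤ deltaReg Γ i.P.d i.P.ε (i.P.mesh (j.val + 1)) := fun j =>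
      mul_nonneg (mul_nonneg (mul_nonneg (Consts.cA_nonneg hΓ) i.P.hε.le) (Real.rpow_nonneg (i.P.mesh_pos _).le _))
        (pFn_nonneg' hΓ (i.P.mesh_pos _) ((i.mesh_le_eps0 (Nat.succ_le_of_lt j.isLt)).trans hΓ.ε₀_le_one))
    have hsmall : ∀ j : Fin i.K, 8 * (i.P.d : ℝ) ^ 4 * (i.P.L : ℝ) ^ i.P.d * i.C.e ^ 2 * i.P.mesh (j.val + 1) ^ 2 *
        ((i.P.L : ℝ) ^ (j.val + 1)) ^ 2 * deltaReg Γ i.P.d i.P.ε (i.P.mesh (j.val + 1)) ^ 2 ≤ 1 / 2 := by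
      intro j
      rw [i.hCe]
      exact small_of_thresholds hΓ hd3 hsm' (i.P.mesh_pos _) (i.mesh_le_eps0 (Nat.succ_le_of_lt j.isLt))
        (i.mesh_eq_pow_mul_eps (j.val + 1))
    obtain ⟨-, -, -, -, -, hΦ⟩ := hr
    have h := prop31_regular_tower i.T i.C i.field i.hK hε1 hQa hL hm hδ hreg hsmall hγpos.le hγB' hγ16
      (fun j => thrφ Γ i.P.d (i.P.mesh (j.val + 1))) i.Φ hΦ
    simp only [printedP31Fam]
    rw [sum_range_natExt, sum_range_natExt, sum_Icc_eq_sum_fin']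
    -- the error: `Σ_j 64γ₀d³e²(Lᵏ)²δ_k²·(Ψ_k²s^d|Λ_k|) ≤ Σ_j γ₀·Mconst·(Lʲ⁺¹ε)^{κ₀}|Λ_{j+1}|`
    have herr : ∑ j : Fin i.K, 64 * γ₀ * (i.P.d : ℝ) ^ 3 * i.C.e ^ 2 * ((i.P.L : ℝ) ^ (j.val + 1)) ^ 2 *
          deltaReg Γ i.P.d i.P.ε (i.P.mesh (j.val + 1)) ^ 2 *
          (thrφ Γ i.P.d (i.P.mesh (j.val + 1)) ^ 2 * i.P.mesh (j.val + 1) ^ i.P.d * ((i.T.regions.block j).card : ℝ))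
        ≤ ∑ j : Fin i.K, γ₀ * Mconst Γ Q.d Q.κ₀ * ((Q.L : ℝ) ^ (j.val + 1) * i.P.mesh 0) ^ Q.κ₀ *
          ((i.vol (j.val + 1) : ℕ) : ℝ) := by
      refine Finset.sum_le_sum fun j _ => ?_
      rw [i.vol_succ j, ← i.hL, ← mesh_eq (j.val + 1), i.hCe]
      have hc : 0 ≤ ((i.T.regions.block j).card : ℝ) := Nat.cast_nonneg _
      have hs1 : i.P.mesh (j.val + 1) ≤ 1 := (i.mesh_le_eps0 (Nat.succ_le_of_lt j.isLt)).trans hΓ.ε₀_le_one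
      have hE := err_le_of_thresholds hΓ i.P.d hκ' (i.P.mesh_pos (j.val + 1)) hs1 (i.mesh_eq_pow_mul_eps (j.val + 1))
      have hE' : Mconst Γ i.P.d Q.κ₀ = Mconst Γ Q.d Q.κ₀ := by rw [i.hd]
      rw [hE'] at hE
      have h1 := mul_le_mul_of_nonneg_right (mul_le_mul_of_nonneg_left hE hγpos.le) hc
      calc 64 * γ₀ * (i.P.d : ℝ) ^ 3 * Γ.e ^ 2 * ((i.P.L : ℝ) ^ (j.val + 1)) ^ 2 *
            deltaReg Γ i.P.d i.P.ε (i.P.mesh (j.val + 1)) ^ 2 *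
            (thrφ Γ i.P.d (i.P.mesh (j.val + 1)) ^ 2 * i.P.mesh (j.val + 1) ^ i.P.d * ((i.T.regions.block j).card : ℝ))
          = γ₀ * (64 * (i.P.d : ℝ) ^ 3 * Γ.e ^ 2 * ((i.P.L : ℝ) ^ (j.val + 1)) ^ 2 *
            deltaReg Γ i.P.d i.P.ε (i.P.mesh (j.val + 1)) ^ 2 *
            (thrφ Γ i.P.d (i.P.mesh (j.val + 1)) ^ 2 * i.P.mesh (j.val + 1) ^ i.P.d)) * ((i.T.regions.block j).card : ℝ) := by
            ring
        _ ≤ γ₀ * (Mconst Γ Q.d Q.κ₀ * i.P.mesh (j.val + 1) ^ Q.κ₀) * ((i.T.regions.block j).card : ℝ) := h1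
        _ = γ₀ * Mconst Γ Q.d Q.κ₀ * i.P.mesh (j.val + 1) ^ Q.κ₀ * ((i.T.regions.block j).card : ℝ) := by ring
    have hb : ∀ j : Fin i.K, i.bondKA j = ∑ c : HiggsLattice.PBond i.P (j.val + 1), if Inside (i.T.regions.block j) c then
        i.P.mesh (j.val + 1) ^ i.P.d *
          ‖covDeriv i.C (barA (j.val + 1) i.field) (extL i.T.regions j (resL i.T.regions j i.Φ)) c‖ ^ 2 else 0 :=
      fun j => rfl
    simp only [hb]
    linarith [h, herr]
  · -- the zero-field clause
    have hA : i.field = 0 := hz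
    have hL : 1 < i.P.L := by rw [i.hL]; exact hQL
    have hε1 : i.P.mesh i.K ≤ 1 := i.hε₀.trans hΓ.ε₀_le_one
    have h0 := prop31_zeroField_concrete i.T.regions i.C i.T.nested_regions i.hK hε1 hQa hL hm i.Φ
    simp only [printedP31Fam]
    rw [sum_range_natExt, sum_range_natExt]
    have hb : ∀ j : Fin i.K, i.bondKA j = bondK i.T.regions j (resL i.T.regions j i.Φ) := by
      intro j
      unfold RMultiP.bondKA
      rw [hA]
      exact bondSum_zero i.T.regions i.C j (resL i.T.regions j i.Φ)
    simp only [hb]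
    rw [hA]
    have hle : γ₀ ≤ gamma0 i.P Q.a m2 := by
      have := gamma0_le (P := i.P) hQa hL hm.le
      rw [i.hd, i.hL] at this
      exact this
    have hbn : 0 ≤ bond0 i.T.regions i.C (0 : HiggsLattice.VecField i.P 0) i.Φ.1
        + ∑ j, bondK i.T.regions j (resL i.T.regions j i.Φ) :=
      add_nonneg (bond0_nonneg i.T.regions i.C _ i.Φ.1) (Finset.sum_nonneg fun j _ => bondK_nonneg i.T.regions j _)
    have hmn : 0 ≤ mass0 i.T.regions m2 i.Φ.1 + ∑ j, massK i.T.regions m2 j (resL i.T.regions j i.Φ) :=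
      add_nonneg (mass0_nonneg i.T.regions hm.le i.Φ.1)
        (Finset.sum_nonneg fun j _ => massK_nonneg i.T.regions hm.le j _)
    have h1 := mul_le_mul_of_nonneg_right hle hbn
    have h2 := mul_le_mul_of_nonneg_right hle hmn
    linarith [h0, h1, h2]

/-! ## §5 `B2.Ineq329Printed` (the per-scale (3.29)) on the family over the printed restrictions -/

/-- **THE FAMILY OF `B2.I329Setting` OVER THE PRINTED RESTRICTIONS** (one instance per restricted-data instance `i` and scale
`k = j + 1`): `s = Lᵏε`, `massSq = m²`, `restricted` as above, `form = ⟨φ′_k, Δ⁽ᵏ⁾(Bᵏ(Λ_k), Ã^η)φ′_k⟩ = termForm` ((3.28)),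
`covDiffSq = Σ_{⟨y,y′⟩⊂Λ_k}|U(Ã(⟨y,y′⟩))φ′_k(y′) − φ′_k(y)|²` (`bondKA`, the rescaling `φ′_k = (Lᵏε)^{(d−2)/2}φ_k` of p. 590),
`l2sq = Σ_{y∈Λ_k}|φ′_k(y)|² = (Lᵏε)⁻²Σ(Lᵏε)^d|φ_k(y)|²`, `vol = |Λ_k|`. [cite: Balaban1982Higgs2, (3.29) p.590] -/
def printed329Fam (Q : B2.Params) (Γ : B2Prop31Thresholds.Consts) (m2 : ℝ) (ij : Σ i : RMultiP Q Γ m2, Fin i.K) : B2.I329Setting where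
  s := ij.1.P.mesh (ij.2.val + 1)
  massSq := m2
  restricted := ij.1.restricted
  form := termForm ij.1.T.regions ij.1.C Q.a ij.1.field m2 ij.2 (resL ij.1.T.regions ij.2 ij.1.Φ)
  covDiffSq := ij.1.bondKA ij.2
  l2sq := (ij.1.P.mesh (ij.2.val + 1))⁻¹ ^ 2 *
    ∑ y : LSite ij.1.T.regions ij.2, ij.1.P.mesh (ij.2.val + 1) ^ ij.1.P.d * ‖resL ij.1.T.regions ij.2 ij.1.Φ y‖ ^ 2
  vol := (ij.1.T.regions.block ij.2).card

/-- **THE CELL'S TYPED (3.29) `B2.Ineq329Printed Q.κ₀` HOLDS ON THE FAMILY OVER THE PRINTED RESTRICTIONS** — *"with a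
constant γ₀ independent of k, Λ_k and for φ′_k, Ã^η satisfying suitable restrictions"*, the restrictions being the PRINTED
thresholds and the error `C(Lᵏε)^{κ₀}|Λ_k|` DERIVED (`hreg_of_restricted`, `small_of_thresholds`, `err_le_of_thresholds`,
then `B2Ineq329RegularField.ineq329_regular_concrete`): for every `Q` with `Q.L > 1`, `Q.a > 0`, `2 ≤ Q.d ≤ 3`,
`Q.κ₀ < 2 − Q.d/2`, valid `Γ` with `SmallEps`, `m² ≥ 0`; `γ₀ = min(a(1 − L⁻²)/(8d + 2m² + 4), 1/16)`, `C = γ₀·Mconst`.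
[cite: Balaban1982Higgs2, (3.29) p.590] [cite: Balaban1983RegularityDecay, Prop. 3.1′ (1.21)–(1.22) p.574] -/
theorem ineq329Printed_thresholds (Q : B2.Params) (hQL : 1 < Q.L) (hQa : 0 < Q.a) (hQd2 : 2 ≤ Q.d) (hQd3 : Q.d ≤ 3)
    (hκ : Q.κ₀ < 2 - (Q.d : ℝ) / 2) (Γ : B2Prop31Thresholds.Consts) (hΓ : Γ.Valid) (hsm : SmallEps Q.d Q.L Γ) {m2 : ℝ}
    (hm : 0 ≤ m2) : B2.Ineq329Printed Q.κ₀ (printed329Fam Q Γ m2) := by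
  set γ₀ : ℝ := min (Q.a * (1 - ((Q.L : ℝ) ^ 2)⁻¹) / (8 * Q.d + 2 * m2 + 4)) (1 / 16) with hγ₀
  have hQL' : (1 : ℝ) < Q.L := by exact_mod_cast hQL
  have hQd' : (2 : ℝ) ≤ Q.d := by exact_mod_cast hQd2
  have hB0 : 0 < 8 * (Q.d : ℝ) + 2 * m2 + 4 := by linarith
  have hainf0 : 0 < Q.a * (1 - ((Q.L : ℝ) ^ 2)⁻¹) := by
    have h1 : (1 : ℝ) < (Q.L : ℝ) ^ 2 := by nlinarith
    have : ((Q.L : ℝ) ^ 2)⁻¹ < 1 := inv_lt_one_of_one_lt₀ h1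
    exact mul_pos hQa (by linarith)
  have hγpos : 0 < γ₀ := lt_min (div_pos hainf0 hB0) (by norm_num)
  have hγ16 : γ₀ ≤ 1 / 16 := min_le_right _ _
  have hγB : γ₀ * (8 * Q.d + 2 * m2 + 4) ≤ Q.a * (1 - ((Q.L : ℝ) ^ 2)⁻¹) := by
    calc γ₀ * (8 * Q.d + 2 * m2 + 4) ≤ Q.a * (1 - ((Q.L : ℝ) ^ 2)⁻¹) / (8 * Q.d + 2 * m2 + 4) * (8 * Q.d + 2 * m2 + 4) :=
          mul_le_mul_of_nonneg_right (min_le_left _ _) hB0.le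
      _ = Q.a * (1 - ((Q.L : ℝ) ^ 2)⁻¹) := div_mul_cancel₀ _ hB0.ne'
  have hM := Mconst_nonneg hΓ Q.d Q.κ₀
  refine ⟨γ₀, γ₀ * Mconst Γ Q.d Q.κ₀, hγpos, mul_nonneg hγpos.le hM, fun ij hr => ?_⟩
  obtain ⟨i, j⟩ := ij
  have hL : 1 < i.P.L := by rw [i.hL]; exact hQL
  have hd2 : 2 ≤ i.P.d := by rw [i.hd]; exact hQd2
  have hd3 : i.P.d ≤ 3 := by rw [i.hd]; exact hQd3
  have hγB' : γ₀ * (8 * i.P.d + 2 * m2 + 4) ≤ Q.a * (1 - ((i.P.L : ℝ) ^ 2)⁻¹) := by rw [i.hd, i.hL]; exact hγB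
  have hsm' : SmallEps i.P.d i.P.L Γ := by rw [i.hd, i.hL]; exact hsm
  have hκ' : Q.κ₀ < 2 - (i.P.d : ℝ) / 2 := by rw [i.hd]; exact hκ
  have hs1 : i.P.mesh (j.val + 1) ≤ 1 := (i.mesh_le_eps0 (Nat.succ_le_of_lt j.isLt)).trans hΓ.ε₀_le_one
  have hreg := hreg_of_restricted hΓ i hd2 hr
  have hδ : 0 ≤ deltaReg Γ i.P.d i.P.ε (i.P.mesh (j.val + 1)) :=
    mul_nonneg (mul_nonneg (mul_nonneg (Consts.cA_nonneg hΓ) i.P.hε.le) (Real.rpow_nonneg (i.P.mesh_pos _).le _))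
      (pFn_nonneg' hΓ (i.P.mesh_pos _) hs1)
  have hsmall : 8 * (i.P.d : ℝ) ^ 4 * (i.P.L : ℝ) ^ i.P.d * i.C.e ^ 2 * i.P.mesh (j.val + 1) ^ 2 *
      ((i.P.L : ℝ) ^ (j.val + 1)) ^ 2 * deltaReg Γ i.P.d i.P.ε (i.P.mesh (j.val + 1)) ^ 2 ≤ 1 / 2 := by
    rw [i.hCe]
    exact small_of_thresholds hΓ hd3 hsm' (i.P.mesh_pos _) (i.mesh_le_eps0 (Nat.succ_le_of_lt j.isLt))
      (i.mesh_eq_pow_mul_eps (j.val + 1))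
  obtain ⟨-, -, -, -, -, hΦ⟩ := hr
  have h := ineq329_regular_concrete i.T.regions i.C i.hK hQa hL hm i.field j hs1 hδ (hreg j) hsmall hγpos.le hγB'
    hγ16 (resL i.T.regions j i.Φ)
  have hMψ := l2_le_of_sup i.T.regions j (resL i.T.regions j i.Φ) (hΦ j)
  simp only [printed329Fam]
  -- the mass term: `m² s² · s⁻² Σ s^d|ψ|² = massK`
  have hs0 : i.P.mesh (j.val + 1) ≠ 0 := (i.P.mesh_pos _).ne'
  have hmass : m2 * i.P.mesh (j.val + 1) ^ 2 * ((i.P.mesh (j.val + 1))⁻¹ ^ 2 *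
      ∑ y : LSite i.T.regions j, i.P.mesh (j.val + 1) ^ i.P.d * ‖resL i.T.regions j i.Φ y‖ ^ 2)
      = massK i.T.regions m2 j (resL i.T.regions j i.Φ) := by
    rw [massK, Finset.mul_sum, Finset.mul_sum]
    refine Finset.sum_congr rfl fun y _ => ?_
    field_simp
  rw [hmass]
  -- the error: `64γ₀d³e²(Lᵏ)²δ_k² Σ s^d|ψ|² ≤ γ₀·Mconst·s^{κ₀}|Λ_k|`
  have hc64 : 0 ≤ 64 * γ₀ * (i.P.d : ℝ) ^ 3 * i.C.e ^ 2 * ((i.P.L : ℝ) ^ (j.val + 1)) ^ 2 *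
      deltaReg Γ i.P.d i.P.ε (i.P.mesh (j.val + 1)) ^ 2 := by positivity
  have e1 := mul_le_mul_of_nonneg_left hMψ hc64
  have hE := err_le_of_thresholds hΓ i.P.d hκ' (i.P.mesh_pos (j.val + 1)) hs1 (i.mesh_eq_pow_mul_eps (j.val + 1))
  have hE' : Mconst Γ i.P.d Q.κ₀ = Mconst Γ Q.d Q.κ₀ := by rw [i.hd]
  rw [hE', ← i.hCe] at hE
  have e2 := mul_le_mul_of_nonneg_right (mul_le_mul_of_nonneg_left hE hγpos.le)
    (Nat.cast_nonneg (i.T.regions.block j).card)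
  have e3 : 64 * γ₀ * (i.P.d : ℝ) ^ 3 * i.C.e ^ 2 * ((i.P.L : ℝ) ^ (j.val + 1)) ^ 2 *
        deltaReg Γ i.P.d i.P.ε (i.P.mesh (j.val + 1)) ^ 2 *
        (thrφ Γ i.P.d (i.P.mesh (j.val + 1)) ^ 2 * i.P.mesh (j.val + 1) ^ i.P.d * ((i.T.regions.block j).card : ℝ))
      = γ₀ * (64 * (i.P.d : ℝ) ^ 3 * i.C.e ^ 2 * ((i.P.L : ℝ) ^ (j.val + 1)) ^ 2 *
        deltaReg Γ i.P.d i.P.ε (i.P.mesh (j.val + 1)) ^ 2 *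
        (thrφ Γ i.P.d (i.P.mesh (j.val + 1)) ^ 2 * i.P.mesh (j.val + 1) ^ i.P.d)) * ((i.T.regions.block j).card : ℝ) := by
    ring
  have hb : i.bondKA j = ∑ c : HiggsLattice.PBond i.P (j.val + 1), if Inside (i.T.regions.block j) c then
      i.P.mesh (j.val + 1) ^ i.P.d *
        ‖covDeriv i.C (barA (j.val + 1) i.field) (extL i.T.regions j (resL i.T.regions j i.Φ)) c‖ ^ 2 else 0 := rfl
  rw [hb]
  linarith [h, e1, e2, e3]

end Main

/-! ## §6 Non-vacuity: a restricted instance with a NON-ZERO (constant) external field -/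

section Nonvacuity

variable (Q : B2.Params) (Γ : B2Prop31Thresholds.Consts) (m2 : ℝ)

/-- The one-step lattice data of the witness: `d := Q.d`, `L := Q.L`, `K = 1`, `M = L'_μ = 1`, `ε := ε₀/L` (so `Lε = ε₀`).
[cite: Balaban1982Higgs1, (1.2) p.604] -/
def witnessParams (hQd : 1 ≤ Q.d) (hQL : 1 < Q.L) (hε : 0 < Γ.ε₀) : HiggsLattice.Params where
  d := Q.d
  ε := Γ.ε₀ / Q.L
  K := 1
  L := Q.L
  M := 1
  Lp := fun _ => 1
  hd := hQd
  hε := div_pos hε (by exact_mod_cast (zero_lt_one.trans hQL))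
  hL := zero_lt_one.trans hQL
  hM := one_pos
  hLp := fun _ => one_pos

/-- The one-step tower of the witness: `Λ₅⁽⁰⁾ = T_ε`, `Λ₅⁽¹⁾ = ∅` (so `Λ₁ = T⁽¹⁾`). [cite: Balaban1982Higgs2, (3.23) p.588] -/
def witnessTower (P : HiggsLattice.Params) : Tower P 1 where
  lam := fun k => if k = 0 then Finset.univ else ∅
  top := by simp
  isUnion := by
    intro k hk x x' _
    have hk0 : k = 0 := by omega
    simp [hk0]
  nested := by
    intro k hk x hx
    have hk0 : k = 0 := by omega
    simp [hk0] at hx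

/-- **NON-VACUITY**: for `Q.d ≥ 1`, `Q.L > 1`, valid `Γ`, every `m²`, the family has a RESTRICTED instance whose field `Ã^ε` is
NOT zero — one step (`K = 1`, `Lε = ε₀`), `θ₁ ≡ 1`, `A₀ = 0`, `A^{(1),ε} ≡ 1 ≡ A_1` (a constant external field: all differences
in the restrictions vanish, the thresholds are non-negative), `Φ = 0`. [cite: Balaban1982Higgs2, Prop. 3.1 p.589] -/
theorem exists_restricted_ne_zero (hQd : 1 ≤ Q.d) (hQL : 1 < Q.L) (hΓ : Γ.Valid) :
    ∃ i : RMultiP Q Γ m2, i.restricted ∧ i.field ≠ 0 := by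
  set P : HiggsLattice.Params := witnessParams Q Γ hQd hQL hΓ.ε₀_pos with hP
  have hmesh1 : P.mesh 1 = Γ.ε₀ := by
    show (Q.L : ℝ) ^ 1 * (Γ.ε₀ / Q.L) = Γ.ε₀
    have : (Q.L : ℝ) ≠ 0 := by exact_mod_cast (zero_lt_one.trans hQL).ne'
    field_simp
  let C : ChargeData 1 := ⟨Γ.e, 0,
    by rw [neg_zero]; exact star_zero (EuclideanSpace ℝ (Fin 1) →L[ℝ] EuclideanSpace ℝ (Fin 1)),
    by rw [norm_zero]; exact zero_le_one⟩
  let θ : ℕ → HiggsLattice.Site P 0 → ℝ := fun k _ => if k = 1 then 1 else 0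
  have hθn : Nested θ := by
    intro j z hj
    simp only [θ]
    have hj1 : j + 1 ≠ 1 := by omega
    simp only [hj1, if_false, zero_mul]
  let i : RMultiP Q Γ m2 :=
    { P := P, hL := rfl, hd := rfl, N := 1, K := 1, hK := le_rfl, hε₀ := hmesh1.le, T := witnessTower P, C := C, hCe := rfl,
      θ := θ, θ_nested := hθn,
      θ_range := fun m z => by simp only [θ]; split_ifs <;> norm_num,
      θ_one := fun k hk1 hkK z _ => by
        have hk : k = 1 := by omega
        simp [θ, hk],
      θ_zero := fun k hk z _ => by omega,
      θ_above := fun m hm z => by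
        have hm1 : m ≠ 1 := by omega
        simp [θ, hm1],
      θ_lip := fun k z ν => by
        simp only [θ, sub_self, abs_zero]
        exact mul_nonneg hΓ.cθ_nonneg (inv_nonneg.2 (pow_nonneg (Nat.cast_nonneg _) _)),
      A₀ := 0, A := fun _ _ => 1, Ac := fun _ _ => 1, Φ := 0 }
  have hs : ∀ j : Fin 1, 0 < i.P.mesh (j.val + 1) ∧ i.P.mesh (j.val + 1) ≤ 1 := fun j => by
    have : j.val = 0 := by omega
    rw [this]
    exact ⟨i.P.mesh_pos 1, hmesh1.le.trans hΓ.ε₀_le_one⟩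
  refine ⟨i, ⟨?_, ?_, ?_, ?_, ?_, ?_⟩, ?_⟩
  · intro j z _ μ ν
    show |(1 : ℝ) - 1| ≤ _
    rw [sub_self, abs_zero]
    exact mul_nonneg (mul_nonneg (mul_nonneg hΓ.c₅_nonneg i.P.hε.le) (Real.rpow_nonneg (hs j).1.le _))
      (pFn_nonneg' hΓ (hs j).1 (hs j).2)
  · intro j z _ μ
    show |(1 : ℝ) - 1| ≤ _
    rw [sub_self, abs_zero]
    exact mul_nonneg (mul_nonneg hΓ.c₃_nonneg (Real.rpow_nonneg (hs j).1.le _)) (pFn_nonneg' hΓ (hs j).1 (hs j).2)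
  · intro j z _ μ ν hsl
    exfalso
    rcases hsl with h | h <;> exact h (by simp [i, θ])
  · intro j z _ μ ν hsl
    exfalso
    rcases hsl with h | h <;> exact h (by simp [i, θ])
  · intro j z _ μ ν hsl
    exfalso
    rcases hsl with h | h <;> exact h (by simp [i, θ])
  · intro j y
    simp only [i]
    show ‖(0 : V 1)‖ ≤ _
    rw [norm_zero]
    exact mul_nonneg (mul_nonneg (mul_nonneg hΓ.cφ_nonneg (Real.rpow_nonneg hΓ.lam_pos.le _))
      (Real.rpow_nonneg (hs j).1.le _)) (pFn_nonneg' hΓ (hs j).1 (hs j).2)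
  · -- the field is the constant 1 on every bond
    intro h0
    have hb : i.field ⟨default, ⟨0, hQd⟩⟩ = 1 := by
      show field32 θ 0 (fun _ _ => (1 : ℝ)) 1 ⟨default, ⟨0, hQd⟩⟩ = 1
      rw [field32_apply]
      simp [θ]
    rw [h0] at hb
    exact zero_ne_one hb

end Nonvacuity


end Literature.MathematicalPhysics.QuantumFieldTheory.Balaban1983to89.B2Prop31PrintedRestrictions

end
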